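import Summits.HodgeConjecture.HodgeConjecture.Theorems.F0P3cStCharTSTubeModelTransport   -- ★ p851879 (J6-T): `isMulLeftInvariant_map_of_continuousMulEquiv`, `map_apply_eq_preimage`; brings ★ `localNonsplitEquiv`, ★ `coe_localNonsplitEquiv_apply`
import Literature.LinearAlgebra.Matrix.CharpolyDiscTwinBridge                              -- ★ `discr_map_of_monic` (the discriminant of a monic polynomial commutes with ring maps)
import Literature.NumberTheory.Rogawski1990.CMLocalAPacketMembers                           -- ★ `Gqs L v = U(Φ₃)(L⁺_v)` (the (S-𝔇) datum's carrier), `qsForm`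
import Summits.HodgeConjecture.HodgeConjecture.Theorems.F0P3cStCharTSDGField              -- ★ p851395 (F0P3-p02) DG-FIELD: `continuous_dgFormula` (the `hDGliO` integrand's base is continuous on `Gqs L v`)
import Summits.HodgeConjecture.HodgeConjecture.Theorems.F0P3cStCharTSHCDLocIntTransport    -- ★ (F0P2-p01 g23) «HC-D» D7-prep: `locallyIntegrable_of_forall_exists_setLIntegral_lt_top`, `enorm_inv_coe_le_inv_coe`
import Literature.NumberTheory.GaloisRepresentations.LocalField                             -- ★ `IsNonarchimedeanLocalField.normAbs`
import Mathlib.MeasureTheory.Function.LocallyIntegrable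
import HarnessLib

/-!
# F0 · P3c · line LH6 «StCharTS» — ROAD «HC-D» brick (D7-T) «CM TRANSPORT OF (HC-D)»: `|D_G|^{−1∕2} ∈ L¹_loc` passes from the one-place model
# `U(σ_w, Φ₃)(L_w)` to the datum's carrier `U(Φ₃)(L⁺_v) = Gqs L v` along `e = localNonsplitEquiv` (Harish-Chandra 1970 Part VII §1 Thm. 15; Platonov–Rapinchuk §5.1)

Cell `pub/hodgecm-mathlib`, crux H413 = `stmt-HodgeConjecture-24833` (lane `--supports … --as helper`); seat LH6-p03 (g6) (heir of the «JAC-LOC» road holder),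
offer (D7-T) to the «HC-D» road holder F0P2-p01 (g23) (F0∕P3b bus 2026-09-02).  THEOREMS ONLY; no definition ∕ instance ∕ notation ∕ named fact ∕ `sorry`.
HONEST LABEL: count-neutral plumbing; closes no organ.  HC_CM is proved only modulo the 7 printed citations (2 remaining: hLiu418 = `stmt-HodgeConjecture-24832`,
h413 = `stmt-HodgeConjecture-24833`) until rung 0 closes.

WHAT.  The named input `hDGliO` of ★ RUNG0 (`F0P3cStCharTSRung0Two.ellipticPackage_hyps_of_namedBlock`, = the (G1) terminal head of road «HC-D») reads, for `v` non-split
and `νQv` Haar on `Gqs L v`:  `LocallyIntegrable (g ↦ (√√(Π_w |discr(χ_g)|_w · (Π_w |det g|_w)⁻²))⁻¹) νQv`  — Harish-Chandra's «`|D_G|^{−1∕2}` is locally summable».  Road «HC-D»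
proves it chart by chart on the one-place MODEL `U′ = U(σ_w, Φ₃)(L_w) ≤ GL₃(L_w)` over the local FIELD `L_w` (D1–D6).  This file is the last arrow (the transport half of D7):
* §1 `locallyIntegrable_comp_continuousMulEquiv_of_forall` — GENERIC: for a bi-continuous group isomorphism `e : G ≃ₜ* G′` and a Haar measure `ν` on `G`, if `F` is locally
  integrable for EVERY Haar measure of `G′` then `F ∘ e` is locally integrable for `ν` (`e_* ν` is Haar; Mathlib `locallyIntegrable_map_homeomorph`);
* §2 TOKEN IDENTITIES at `e = localNonsplitEquiv c Φ₃ hc w hw` (entrywise evaluation at the one place `w ∣ v`, ★ `coe_localNonsplitEquiv_apply`):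
  `discr(χ_{e g}) = discr(χ_g)(w)` (Mathlib `charpoly_map` + ★ `discr_map_of_monic`), `det(e g) = (det g)(w)` (`RingHom.map_det`), and `Π_{w′} |x_{w′}|_{w′} = |x_w|_w`
  (one place above `v`); hence the `hDGliO` integrand at `g` IS the one-place integrand `(√√(|discr(χ_{g′})|_w · |det g′|_w⁻²))⁻¹` at `g′ = e g` (`weylDiscrInv_eq_model`);
* §3 HEAD `locallyIntegrable_weylDiscr_inv_of_model` — the (G1) conclusion VERBATIM from the model statement «for every Haar `ν′` on `U′`, the one-place integrand is
  locally integrable» (`hmodel`), so that D7 proper = D5 GLOBAL ∘ D6(a) on the MODEL only and the `Gqs ∕ Π_w ∕ LocalRing` plumbing never enters those files;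
* §4 the same from the road's `ℝ≥0∞` currency (ruling R2 ∕ (F-D6) §4 head): `θ M := (↑(√√(|discr(χ_M)|_w · |det M|_w⁻²)))⁻¹ : ℝ≥0∞` and «`∀ g₀′, ∃ U ∈ 𝓝 g₀′, ∫⁻_U θ(g′) dν′ < ∞`»
  ⇒ `hmodel` (★ D7-prep `locallyIntegrable_of_forall_exists_setLIntegral_lt_top` + `enorm_inv_coe_le_inv_coe` of F0P2-p01; continuity of the base through ★ `continuous_dgFormula`
  read back along `e`) ⇒ HEAD `locallyIntegrable_weylDiscr_inv_of_model_lintegral` (D7 then = (F-D6) §4 at `G := U′`, `ρ := U′.subtype` ∘ D5 GLOBAL, one `exact`).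

## References
* [HarishChandra1970] Harish-Chandra, *Harmonic analysis on reductive p-adic groups*, LNM 162 (1970), Part VII §1 Thm. 15 (`|D_G|^{−1∕2}` locally summable).
* [PlatonovRapinchuk1994] V. Platonov, A. Rapinchuk, *Algebraic Groups and Number Theory* (1994), §5.1 (local points at a non-split place).
* [Rogawski1990] J. D. Rogawski, *Automorphic Representations of Unitary Groups in Three Variables*, Ann. of Math. Stud. 123 (1990), §4.9 p. 54 (`D_G`), §12.5 p. 182.
* [WeilBNT1967] A. Weil, *Basic Number Theory* (1967), Ch. I §2 (modules on finite products of local fields).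
-/

set_option autoImplicit false
-- the mandated namespace has the single-problem summit's repeated segment (`HodgeConjecture.HodgeConjecture`)
set_option linter.dupNamespace false

noncomputable section

open MeasureTheory Measure Set Filter Topology
open scoped ENNReal NNReal MatrixGroups
open Matrix NumberField IsDedekindDomain
open Literature.NumberTheory Literature.NumberTheory.Automorphic Literature.NumberTheory.Automorphic.UnitaryGroup Literature.NumberTheory.Rogawski1990
open Literature.NumberTheory.GaloisRepresentations

namespace Summit.HodgeConjecture.HodgeConjecture.Cruxes.H413.F0P3cStCharTSWeylDiscrTransport

/-! ## §1 Local integrability pulls back along a bi-continuous group isomorphism carrying Haar to Haar -/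

section Generic

variable {G G' : Type*} [Group G] [Group G'] [TopologicalSpace G] [TopologicalSpace G']
  [MeasurableSpace G] [BorelSpace G] [MeasurableSpace G'] [BorelSpace G']
  {E : Type*} [NormedAddCommGroup E]

/-- **`F` locally integrable for `e_* ν` ⇒ `F ∘ e` locally integrable for `ν`** (`e` a homeomorphism; Mathlib `locallyIntegrable_map_homeomorph`). [cite: WeilBNT1967, Ch. I §2] -/
theorem locallyIntegrable_comp_continuousMulEquiv (e : G ≃ₜ* G') (ν : Measure G) {F : G' → E}
    (h : LocallyIntegrable F (ν.map e)) : LocallyIntegrable (fun g => F (e g)) ν := by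
  have h' : LocallyIntegrable F (Measure.map e.toHomeomorph ν) := h
  exact (locallyIntegrable_map_homeomorph e.toHomeomorph).1 h'

/-- **Transport of local integrability along `e : G ≃ₜ* G′`**: if `F` is locally integrable for EVERY Haar measure of `G′`, then `F ∘ e` is locally integrable for
every Haar measure `ν` of `G` (`e_* ν` is a Haar measure of `G′`, Mathlib `ContinuousMulEquiv.isHaarMeasure_map`). [cite: WeilBNT1967, Ch. I §2] -/
theorem locallyIntegrable_comp_continuousMulEquiv_of_forall [IsTopologicalGroup G] [IsTopologicalGroup G'] (e : G ≃ₜ* G') (ν : Measure G) [ν.IsHaarMeasure] {F : G' → E}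
    (h : ∀ ν' : Measure G', ν'.IsHaarMeasure → LocallyIntegrable F ν') : LocallyIntegrable (fun g => F (e g)) ν :=
  locallyIntegrable_comp_continuousMulEquiv e ν (h (ν.map e) (e.isHaarMeasure_map ν))

end Generic

/-! ## §2 The token identities at `e = localNonsplitEquiv`: `discr`, `det`, and the one-place product -/

section CM

variable (L : Type) [Field L] [NumberField L] [IsCMField L] (v : HeightOneSpectrum (𝓞 ↥(maximalRealSubfield L)))
  (w : PlacesOver L v) (hw : IsCMField.complexConj L • w.1 = w.1)

/-- **The matrix of `e g` is the matrix of `g` read at `w`** (★ `coe_localNonsplitEquiv_apply`, on the carrier `Gqs L v`). [cite: PlatonovRapinchuk1994, §5.1] -/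
theorem coe_coe_localNonsplitEquiv_eq_map (g : Gqs L v) :
    (((localNonsplitEquiv (IsCMField.complexConj L) (Rogawski1990.qsForm L) (IsCMField.complexConj_ne_one L) w hw g :
        ↥(unitaryGroupOfForm (galAdicCompletionMap (L := L) (IsCMField.complexConj L) hw) (placeForm (Rogawski1990.qsForm L) w.1))) :
          GL (Fin 3) (w.1.adicCompletion L)) : Matrix (Fin 3) (Fin 3) (w.1.adicCompletion L)) =
      ((g.val : GL (Fin 3) (UnitaryGroup.LocalRing L v)).val : Matrix (Fin 3) (Fin 3) (UnitaryGroup.LocalRing L v)).map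
        (Pi.evalRingHom (fun w' : PlacesOver L v => w'.1.adicCompletion L) w) :=
  coe_localNonsplitEquiv_apply L (Rogawski1990.qsForm L) v w hw g

/-- **`discr(χ_{e g}) = discr(χ_g)(w)`**: the characteristic polynomial commutes with the evaluation `Π_{w′} L_{w′} → L_w` (Mathlib `charpoly_map`) and so does the discriminant
of a MONIC polynomial (★ `discr_map_of_monic`). [cite: PlatonovRapinchuk1994, §5.1] [cite: Rogawski1990, §4.9 p. 54] -/
theorem charpoly_discr_localNonsplitEquiv (g : Gqs L v) :
    (((localNonsplitEquiv (IsCMField.complexConj L) (Rogawski1990.qsForm L) (IsCMField.complexConj_ne_one L) w hw g :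
        ↥(unitaryGroupOfForm (galAdicCompletionMap (L := L) (IsCMField.complexConj L) hw) (placeForm (Rogawski1990.qsForm L) w.1))) :
          GL (Fin 3) (w.1.adicCompletion L)) : Matrix (Fin 3) (Fin 3) (w.1.adicCompletion L)).charpoly.discr =
      (((g.val : GL (Fin 3) (UnitaryGroup.LocalRing L v)).val.charpoly.discr) w) := by
  rw [coe_coe_localNonsplitEquiv_eq_map L v w hw g, Matrix.charpoly_map,
    Literature.LinearAlgebra.Matrix.discr_map_of_monic _ (Matrix.charpoly_monic _), Pi.evalRingHom_apply]

/-- **`det(e g) = (det g)(w)`** (`RingHom.map_det`). [cite: PlatonovRapinchuk1994, §5.1] -/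
theorem det_localNonsplitEquiv (g : Gqs L v) :
    (((localNonsplitEquiv (IsCMField.complexConj L) (Rogawski1990.qsForm L) (IsCMField.complexConj_ne_one L) w hw g :
        ↥(unitaryGroupOfForm (galAdicCompletionMap (L := L) (IsCMField.complexConj L) hw) (placeForm (Rogawski1990.qsForm L) w.1))) :
          GL (Fin 3) (w.1.adicCompletion L)) : Matrix (Fin 3) (Fin 3) (w.1.adicCompletion L)).det =
      (((g.val : GL (Fin 3) (UnitaryGroup.LocalRing L v)).val.det) w) := by
  rw [coe_coe_localNonsplitEquiv_eq_map L v w hw g, ← RingHom.mapMatrix_apply, ← RingHom.map_det, Pi.evalRingHom_apply]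

include hw in
/-- **One place above `v`**: `Π_{w′ ∣ v} |x_{w′}|_{w′} = |x_w|_w` (`PlacesOver L v` is a singleton at a non-split `v`, ★ `PlacesOver.subsingleton_of_smul_eq`). [cite: WeilBNT1967, Ch. I §2] -/
theorem prod_normAbs_apply_eq (x : UnitaryGroup.LocalRing L v) :
    ∏ w' : PlacesOver L v, IsNonarchimedeanLocalField.normAbs (w'.1.adicCompletion L) (x w') =
      IsNonarchimedeanLocalField.normAbs (w.1.adicCompletion L) (x w) := by
  haveI := PlacesOver.subsingleton_of_smul_eq (IsCMField.complexConj L) (IsCMField.complexConj_ne_one L) w hw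
  exact Fintype.prod_subsingleton _ w

include hw in
/-- **The base `√√(Π_w |discr(χ_g)|_w · (Π_w |det g|_w)⁻²)` IS the one-place base at `e g`** (§2 token identities). [cite: PlatonovRapinchuk1994, §5.1] [cite: Rogawski1990, §4.9 p. 54] -/
theorem weylDiscr_eq_model (g : Gqs L v) :
    NNReal.sqrt (NNReal.sqrt
        ((∏ w' : PlacesOver L v, IsNonarchimedeanLocalField.normAbs (w'.1.adicCompletion L) (((g.val : GL (Fin 3) (UnitaryGroup.LocalRing L v)).val.charpoly.discr) w')) *
          ((∏ w' : PlacesOver L v, IsNonarchimedeanLocalField.normAbs (w'.1.adicCompletion L) (((g.val : GL (Fin 3) (UnitaryGroup.LocalRing L v)).val.det) w')) ^ 2)⁻¹)) =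
      NNReal.sqrt (NNReal.sqrt
        (IsNonarchimedeanLocalField.normAbs (w.1.adicCompletion L)
            (((localNonsplitEquiv (IsCMField.complexConj L) (Rogawski1990.qsForm L) (IsCMField.complexConj_ne_one L) w hw g :
                ↥(unitaryGroupOfForm (galAdicCompletionMap (L := L) (IsCMField.complexConj L) hw) (placeForm (Rogawski1990.qsForm L) w.1))) :
                  GL (Fin 3) (w.1.adicCompletion L)) : Matrix (Fin 3) (Fin 3) (w.1.adicCompletion L)).charpoly.discr *
          ((IsNonarchimedeanLocalField.normAbs (w.1.adicCompletion L)
            (((localNonsplitEquiv (IsCMField.complexConj L) (Rogawski1990.qsForm L) (IsCMField.complexConj_ne_one L) w hw g :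
                ↥(unitaryGroupOfForm (galAdicCompletionMap (L := L) (IsCMField.complexConj L) hw) (placeForm (Rogawski1990.qsForm L) w.1))) :
                  GL (Fin 3) (w.1.adicCompletion L)) : Matrix (Fin 3) (Fin 3) (w.1.adicCompletion L)).det) ^ 2)⁻¹)) := by
  rw [prod_normAbs_apply_eq L v w hw, prod_normAbs_apply_eq L v w hw, charpoly_discr_localNonsplitEquiv L v w hw g, det_localNonsplitEquiv L v w hw g]

include hw in
/-- **The `hDGliO` integrand IS the one-place integrand at `e g`**: `(√√(Π_w |discr(χ_g)|_w · (Π_w |det g|_w)⁻²))⁻¹ = (√√(|discr(χ_{e g})|_w · |det(e g)|_w⁻²))⁻¹`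
(§2 token identities). [cite: HarishChandra1970, Part VII §1 Thm. 15] [cite: Rogawski1990, §4.9 p. 54] [cite: PlatonovRapinchuk1994, §5.1] -/
theorem weylDiscrInv_eq_model (g : Gqs L v) :
    (((NNReal.sqrt (NNReal.sqrt
        ((∏ w' : PlacesOver L v, IsNonarchimedeanLocalField.normAbs (w'.1.adicCompletion L) (((g.val : GL (Fin 3) (UnitaryGroup.LocalRing L v)).val.charpoly.discr) w')) *
          ((∏ w' : PlacesOver L v, IsNonarchimedeanLocalField.normAbs (w'.1.adicCompletion L) (((g.val : GL (Fin 3) (UnitaryGroup.LocalRing L v)).val.det) w')) ^ 2)⁻¹)) : ℝ≥0) : ℝ))⁻¹ =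
      (((NNReal.sqrt (NNReal.sqrt
        (IsNonarchimedeanLocalField.normAbs (w.1.adicCompletion L)
            (((localNonsplitEquiv (IsCMField.complexConj L) (Rogawski1990.qsForm L) (IsCMField.complexConj_ne_one L) w hw g :
                ↥(unitaryGroupOfForm (galAdicCompletionMap (L := L) (IsCMField.complexConj L) hw) (placeForm (Rogawski1990.qsForm L) w.1))) :
                  GL (Fin 3) (w.1.adicCompletion L)) : Matrix (Fin 3) (Fin 3) (w.1.adicCompletion L)).charpoly.discr *
          ((IsNonarchimedeanLocalField.normAbs (w.1.adicCompletion L)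
            (((localNonsplitEquiv (IsCMField.complexConj L) (Rogawski1990.qsForm L) (IsCMField.complexConj_ne_one L) w hw g :
                ↥(unitaryGroupOfForm (galAdicCompletionMap (L := L) (IsCMField.complexConj L) hw) (placeForm (Rogawski1990.qsForm L) w.1))) :
                  GL (Fin 3) (w.1.adicCompletion L)) : Matrix (Fin 3) (Fin 3) (w.1.adicCompletion L)).det) ^ 2)⁻¹)) : ℝ≥0) : ℝ))⁻¹ := by
  rw [weylDiscr_eq_model L v w hw g]

/-! ## §3 HEAD: `hDGliO` on `Gqs L v` from the one-place model statement -/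

include hw in
/-- **(D7-T) (HC-D) ON `U(Φ₃)(L⁺_v)` FROM THE ONE-PLACE MODEL.**  Let `v` be non-split (`c • w = w`), `νQv` a Haar measure on `Gqs L v = U(Φ₃)(L⁺_v)`, and suppose that on the
model `U′ = U(σ_w, Φ₃)(L_w)` the one-place integrand `g′ ↦ (√√(|discr(χ_{g′})|_w · |det g′|_w⁻²))⁻¹` is locally integrable for EVERY Haar measure `ν′` of `U′` (`hmodel`, the
output of road «HC-D» D5 GLOBAL ∘ D6(a) on the model).  Then the `hDGliO` named input of ★ RUNG0 holds VERBATIM: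
`LocallyIntegrable (g ↦ (√√(Π_w |discr(χ_g)|_w · (Π_w |det g|_w)⁻²))⁻¹) νQv`.  Proof: §2 `weylDiscrInv_eq_model` pointwise, then §1 along `e = localNonsplitEquiv`.
[cite: HarishChandra1970, Part VII §1 Thm. 15] [cite: PlatonovRapinchuk1994, §5.1] [cite: Rogawski1990, §4.9 p. 54; §12.5 p. 182] -/
theorem locallyIntegrable_weylDiscr_inv_of_model
    [MeasurableSpace (Gqs L v)] [BorelSpace (Gqs L v)] (νQv : Measure (Gqs L v)) [νQv.IsHaarMeasure]
    [MeasurableSpace ↥(unitaryGroupOfForm (galAdicCompletionMap (L := L) (IsCMField.complexConj L) hw) (placeForm (Rogawski1990.qsForm L) w.1))]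
    [BorelSpace ↥(unitaryGroupOfForm (galAdicCompletionMap (L := L) (IsCMField.complexConj L) hw) (placeForm (Rogawski1990.qsForm L) w.1))]
    (hmodel : ∀ ν' : Measure ↥(unitaryGroupOfForm (galAdicCompletionMap (L := L) (IsCMField.complexConj L) hw) (placeForm (Rogawski1990.qsForm L) w.1)),
      ν'.IsHaarMeasure →
        LocallyIntegrable (fun g' : ↥(unitaryGroupOfForm (galAdicCompletionMap (L := L) (IsCMField.complexConj L) hw) (placeForm (Rogawski1990.qsForm L) w.1)) =>
          (((NNReal.sqrt (NNReal.sqrt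
            (IsNonarchimedeanLocalField.normAbs (w.1.adicCompletion L) ((g' : GL (Fin 3) (w.1.adicCompletion L)) : Matrix (Fin 3) (Fin 3) (w.1.adicCompletion L)).charpoly.discr *
              ((IsNonarchimedeanLocalField.normAbs (w.1.adicCompletion L) ((g' : GL (Fin 3) (w.1.adicCompletion L)) : Matrix (Fin 3) (Fin 3) (w.1.adicCompletion L)).det) ^ 2)⁻¹)) :
                ℝ≥0) : ℝ))⁻¹) ν') :
    LocallyIntegrable (fun g : (Gqs L v) => (((NNReal.sqrt (NNReal.sqrt ((∏ w : PlacesOver L v, IsNonarchimedeanLocalField.normAbs (w.1.adicCompletion L) (((g.val : GL (Fin 3) (UnitaryGroup.LocalRing L v)).val.charpoly.discr) w)) * ((∏ w : PlacesOver L v, IsNonarchimedeanLocalField.normAbs (w.1.adicCompletion L) (((g.val : GL (Fin 3) (UnitaryGroup.LocalRing L v)).val.det) w)) ^ 2)⁻¹)) : ℝ≥0) : ℝ))⁻¹) νQv := by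
  -- the carrier `Gqs L v` is `↥(«local» L c 3 Φ₃ v)` (the domain spelling of `localNonsplitEquiv`) by `rfl`; move the Borel structure across the spelling
  letI : MeasurableSpace ↥(«local» L (IsCMField.complexConj L) 3 (Rogawski1990.qsForm L) v) := ‹MeasurableSpace (Gqs L v)›
  haveI : BorelSpace ↥(«local» L (IsCMField.complexConj L) 3 (Rogawski1990.qsForm L) v) := ‹BorelSpace (Gqs L v)›
  haveI : (show Measure ↥(«local» L (IsCMField.complexConj L) 3 (Rogawski1990.qsForm L) v) from νQv).IsHaarMeasure := ‹νQv.IsHaarMeasure›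
  have key : LocallyIntegrable (fun g : (Gqs L v) => (((NNReal.sqrt (NNReal.sqrt
        (IsNonarchimedeanLocalField.normAbs (w.1.adicCompletion L)
            (((localNonsplitEquiv (IsCMField.complexConj L) (Rogawski1990.qsForm L) (IsCMField.complexConj_ne_one L) w hw g :
                ↥(unitaryGroupOfForm (galAdicCompletionMap (L := L) (IsCMField.complexConj L) hw) (placeForm (Rogawski1990.qsForm L) w.1))) :
                  GL (Fin 3) (w.1.adicCompletion L)) : Matrix (Fin 3) (Fin 3) (w.1.adicCompletion L)).charpoly.discr *
          ((IsNonarchimedeanLocalField.normAbs (w.1.adicCompletion L)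
            (((localNonsplitEquiv (IsCMField.complexConj L) (Rogawski1990.qsForm L) (IsCMField.complexConj_ne_one L) w hw g :
                ↥(unitaryGroupOfForm (galAdicCompletionMap (L := L) (IsCMField.complexConj L) hw) (placeForm (Rogawski1990.qsForm L) w.1))) :
                  GL (Fin 3) (w.1.adicCompletion L)) : Matrix (Fin 3) (Fin 3) (w.1.adicCompletion L)).det) ^ 2)⁻¹)) : ℝ≥0) : ℝ))⁻¹) νQv :=
    locallyIntegrable_comp_continuousMulEquiv_of_forall
      (localNonsplitEquiv (IsCMField.complexConj L) (Rogawski1990.qsForm L) (IsCMField.complexConj_ne_one L) w hw) νQv hmodel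
  refine key.congr (Filter.Eventually.of_forall fun g => ?_)
  exact (weylDiscrInv_eq_model L v w hw g).symm

/-! ## §4 From the road's `ℝ≥0∞` currency: local finiteness of `∫⁻ θ` on the model ⇒ `hmodel` ⇒ `hDGliO` -/

include hw in
/-- **The one-place base `g′ ↦ √√(|discr(χ_{g′})|_w · |det g′|_w⁻²)` is continuous on the model `U′`** — ★ `continuous_dgFormula` on `Gqs L v` read back along the
homeomorphism `e` (§2 `weylDiscr_eq_model` at `e⁻¹ g′`). [cite: Rogawski1990, §4.9 p. 54] [cite: PlatonovRapinchuk1994, §5.1] -/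
theorem continuous_weylDiscr_model :
    Continuous fun g' : ↥(unitaryGroupOfForm (galAdicCompletionMap (L := L) (IsCMField.complexConj L) hw) (placeForm (Rogawski1990.qsForm L) w.1)) =>
      ((NNReal.sqrt (NNReal.sqrt
        (IsNonarchimedeanLocalField.normAbs (w.1.adicCompletion L) ((g' : GL (Fin 3) (w.1.adicCompletion L)) : Matrix (Fin 3) (Fin 3) (w.1.adicCompletion L)).charpoly.discr *
          ((IsNonarchimedeanLocalField.normAbs (w.1.adicCompletion L) ((g' : GL (Fin 3) (w.1.adicCompletion L)) : Matrix (Fin 3) (Fin 3) (w.1.adicCompletion L)).det) ^ 2)⁻¹)) :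
            ℝ≥0) : ℝ) := by
  have hcomp : (fun g' : ↥(unitaryGroupOfForm (galAdicCompletionMap (L := L) (IsCMField.complexConj L) hw) (placeForm (Rogawski1990.qsForm L) w.1)) =>
      ((NNReal.sqrt (NNReal.sqrt
        (IsNonarchimedeanLocalField.normAbs (w.1.adicCompletion L) ((g' : GL (Fin 3) (w.1.adicCompletion L)) : Matrix (Fin 3) (Fin 3) (w.1.adicCompletion L)).charpoly.discr *
          ((IsNonarchimedeanLocalField.normAbs (w.1.adicCompletion L) ((g' : GL (Fin 3) (w.1.adicCompletion L)) : Matrix (Fin 3) (Fin 3) (w.1.adicCompletion L)).det) ^ 2)⁻¹)) :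
            ℝ≥0) : ℝ)) =
      fun g' => ((NNReal.sqrt (NNReal.sqrt
        ((∏ w'' : PlacesOver L v, IsNonarchimedeanLocalField.normAbs (w''.1.adicCompletion L)
            (((((localNonsplitEquiv (IsCMField.complexConj L) (Rogawski1990.qsForm L) (IsCMField.complexConj_ne_one L) w hw).symm g' : Gqs L v).val :
                GL (Fin 3) (UnitaryGroup.LocalRing L v)).val.charpoly.discr) w'')) *
          ((∏ w'' : PlacesOver L v, IsNonarchimedeanLocalField.normAbs (w''.1.adicCompletion L)
            (((((localNonsplitEquiv (IsCMField.complexConj L) (Rogawski1990.qsForm L) (IsCMField.complexConj_ne_one L) w hw).symm g' : Gqs L v).val :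
                GL (Fin 3) (UnitaryGroup.LocalRing L v)).val.det) w'')) ^ 2)⁻¹)) : ℝ≥0) : ℝ) := by
    funext g'
    rw [weylDiscr_eq_model L v w hw, ContinuousMulEquiv.apply_symm_apply]
  rw [hcomp]
  exact (F0P3cStCharTSDGField.continuous_dgFormula L v).comp
    (localNonsplitEquiv (IsCMField.complexConj L) (Rogawski1990.qsForm L) (IsCMField.complexConj_ne_one L) w hw).symm.continuous

include hw in
/-- **`hmodel` FROM THE `ℝ≥0∞` CURRENCY**: if for a measure `ν′` on the model `U′` every point has a neighbourhood `U` with `∫⁻_U θ(g′) dν′ < ∞`, where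
`θ M := (↑(√√(|discr(χ_M)|_w · |det M|_w⁻²)))⁻¹ : ℝ≥0∞` (the `G`-side token of road «HC-D», (F-D6) §4), then the real one-place integrand is locally integrable for `ν′`
(★ D7-prep: `‖·‖ₑ`-domination `enorm_inv_coe_le_inv_coe` + `locallyIntegrable_of_forall_exists_setLIntegral_lt_top`; measurability from `continuous_weylDiscr_model`). [cite: HarishChandra1970, Part VII §1 Thm. 15] -/
theorem locallyIntegrable_model_of_lintegral
    [MeasurableSpace ↥(unitaryGroupOfForm (galAdicCompletionMap (L := L) (IsCMField.complexConj L) hw) (placeForm (Rogawski1990.qsForm L) w.1))]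
    [BorelSpace ↥(unitaryGroupOfForm (galAdicCompletionMap (L := L) (IsCMField.complexConj L) hw) (placeForm (Rogawski1990.qsForm L) w.1))]
    (ν' : Measure ↥(unitaryGroupOfForm (galAdicCompletionMap (L := L) (IsCMField.complexConj L) hw) (placeForm (Rogawski1990.qsForm L) w.1)))
    (hθ : ∀ g₀' : ↥(unitaryGroupOfForm (galAdicCompletionMap (L := L) (IsCMField.complexConj L) hw) (placeForm (Rogawski1990.qsForm L) w.1)),
      ∃ U ∈ 𝓝 g₀', ∫⁻ g' in U,
        ((NNReal.sqrt (NNReal.sqrt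
          (IsNonarchimedeanLocalField.normAbs (w.1.adicCompletion L) ((g' : GL (Fin 3) (w.1.adicCompletion L)) : Matrix (Fin 3) (Fin 3) (w.1.adicCompletion L)).charpoly.discr *
            ((IsNonarchimedeanLocalField.normAbs (w.1.adicCompletion L) ((g' : GL (Fin 3) (w.1.adicCompletion L)) : Matrix (Fin 3) (Fin 3) (w.1.adicCompletion L)).det) ^ 2)⁻¹)) :
              ℝ≥0) : ℝ≥0∞)⁻¹ ∂ν' < ∞) :
    LocallyIntegrable (fun g' : ↥(unitaryGroupOfForm (galAdicCompletionMap (L := L) (IsCMField.complexConj L) hw) (placeForm (Rogawski1990.qsForm L) w.1)) =>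
      (((NNReal.sqrt (NNReal.sqrt
        (IsNonarchimedeanLocalField.normAbs (w.1.adicCompletion L) ((g' : GL (Fin 3) (w.1.adicCompletion L)) : Matrix (Fin 3) (Fin 3) (w.1.adicCompletion L)).charpoly.discr *
          ((IsNonarchimedeanLocalField.normAbs (w.1.adicCompletion L) ((g' : GL (Fin 3) (w.1.adicCompletion L)) : Matrix (Fin 3) (Fin 3) (w.1.adicCompletion L)).det) ^ 2)⁻¹)) :
            ℝ≥0) : ℝ))⁻¹) ν' :=
  F0P3cStCharTSHCDLocIntTransport.locallyIntegrable_of_forall_exists_setLIntegral_lt_top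
    ((continuous_weylDiscr_model L v w hw).measurable.inv.aestronglyMeasurable) _
    (fun _ => F0P3cStCharTSHCDLocIntTransport.enorm_inv_coe_le_inv_coe _) hθ

include hw in
/-- **(D7-T′) (HC-D) ON `U(Φ₃)(L⁺_v)` FROM THE `ℝ≥0∞` MODEL BOUND.**  `v` non-split, `νQv` Haar on `Gqs L v`; if for EVERY Haar measure `ν′` of the model `U′ = U(σ_w, Φ₃)(L_w)`
every point has a neighbourhood of finite `∫⁻ θ(g′) dν′` (`θ` as in `locallyIntegrable_model_of_lintegral` — road «HC-D» (F-D6) §4 at `G := U′`, `ρ := U′.subtype`), then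
the `hDGliO` named input of ★ RUNG0 holds VERBATIM. [cite: HarishChandra1970, Part VII §1 Thm. 15] [cite: PlatonovRapinchuk1994, §5.1] [cite: Rogawski1990, §4.9 p. 54; §12.5 p. 182] -/
theorem locallyIntegrable_weylDiscr_inv_of_model_lintegral
    [MeasurableSpace (Gqs L v)] [BorelSpace (Gqs L v)] (νQv : Measure (Gqs L v)) [νQv.IsHaarMeasure]
    [MeasurableSpace ↥(unitaryGroupOfForm (galAdicCompletionMap (L := L) (IsCMField.complexConj L) hw) (placeForm (Rogawski1990.qsForm L) w.1))]
    [BorelSpace ↥(unitaryGroupOfForm (galAdicCompletionMap (L := L) (IsCMField.complexConj L) hw) (placeForm (Rogawski1990.qsForm L) w.1))]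
    (hθ : ∀ ν' : Measure ↥(unitaryGroupOfForm (galAdicCompletionMap (L := L) (IsCMField.complexConj L) hw) (placeForm (Rogawski1990.qsForm L) w.1)),
      ν'.IsHaarMeasure →
        ∀ g₀' : ↥(unitaryGroupOfForm (galAdicCompletionMap (L := L) (IsCMField.complexConj L) hw) (placeForm (Rogawski1990.qsForm L) w.1)),
          ∃ U ∈ 𝓝 g₀', ∫⁻ g' in U,
            ((NNReal.sqrt (NNReal.sqrt
              (IsNonarchimedeanLocalField.normAbs (w.1.adicCompletion L) ((g' : GL (Fin 3) (w.1.adicCompletion L)) : Matrix (Fin 3) (Fin 3) (w.1.adicCompletion L)).charpoly.discr *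
                ((IsNonarchimedeanLocalField.normAbs (w.1.adicCompletion L) ((g' : GL (Fin 3) (w.1.adicCompletion L)) : Matrix (Fin 3) (Fin 3) (w.1.adicCompletion L)).det) ^ 2)⁻¹)) :
                  ℝ≥0) : ℝ≥0∞)⁻¹ ∂ν' < ∞) :
    LocallyIntegrable (fun g : (Gqs L v) => (((NNReal.sqrt (NNReal.sqrt ((∏ w : PlacesOver L v, IsNonarchimedeanLocalField.normAbs (w.1.adicCompletion L) (((g.val : GL (Fin 3) (UnitaryGroup.LocalRing L v)).val.charpoly.discr) w)) * ((∏ w : PlacesOver L v, IsNonarchimedeanLocalField.normAbs (w.1.adicCompletion L) (((g.val : GL (Fin 3) (UnitaryGroup.LocalRing L v)).val.det) w)) ^ 2)⁻¹)) : ℝ≥0) : ℝ))⁻¹) νQv :=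
  locallyIntegrable_weylDiscr_inv_of_model L v w hw νQv fun ν' hν' => locallyIntegrable_model_of_lintegral L v w hw ν' (hθ ν' hν')

end CM

end Summit.HodgeConjecture.HodgeConjecture.Cruxes.H413.F0P3cStCharTSWeylDiscrTransport

end
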